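import Summits.BirchSwinnertonDyer.BirchSwinnertonDyer.Theorems.PrintCf2RubinValueTwoJLKDescentPseudoNull
import Summits.BirchSwinnertonDyer.BirchSwinnertonDyer.Theorems.PrintCf2RubinValueTwoTwoVariableMCOfBricksPseudoNull
import Summits.BirchSwinnertonDyer.BirchSwinnertonDyer.Theorems.PrintCf2RubinValueTwoLinePinCharIdealAwayCalculus
import Literature.NumberTheory.ComplexMultiplication.EllipticUnits.ImaginaryQuadraticMainConjectureAllPrimes
import HarnessLib

/-!
# (α3) KERNEL DESCENT III — bookkeeping on the Johnson-Leung–Kings skeleton for the UNITS ROW: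
# `char(H¹/𝒥ζ) = char(H¹/ℐ𝒥ζ) = char(H¹/(ℐ𝒥ζ + torsion))` EXACTLY (the `𝒥`-, `ℐ`- and torsion-defects are pseudo-null),
# and exact `char`-equalities from pointwise pseudo-null kernels and cokernels

Cell `bsd-print-cf2`, width seat `bsd-line-cf2c-w8` g7 (prover-bsd-line-cf2c-w8-g7-0), lane **(α3) KERNEL DESCENT** of the planner
brief `Cruxes/MainConjClauseAtSplitTwoQuad/JLK-CARRIER-2-BRIEF-plan-g20.md`, §1 dictionary ROW 2 (units): «`H1 ⧸ D.Z` … (ii) `𝒥`-defect: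
`Λ/𝒥_Λ ≅ ℤ₂`, `Λ/ℐ ≅ ℤ₂` pseudo-null (p0014:L40–48; (T6) `JPseudoNullShape`); Rubin's `𝒞_∞` = the module generated by `ℐ𝒥ζ(𝔤)`,
`𝔤 ∣ 𝔣`, "up to torsion" (§5.4, p0015:L150–153) — consumer's burden (T5)». For the DECIDING research child
`PrintCf2RubinValueTwo.MainConjClauseAtSplitTwoQuadDA` (stmt-BirchSwinnertonDyer-24721), stub (Q); `--supports` it `--as helper`, Theses-free.
Part I = `…JLKDescentPseudoNull` (p719050: f.g. over `ℤ_p` ⟹ pseudo-null; extension closure), Part II = `…JLKDescentAssembly`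
(the abstract descent lemma: (F2) + two comparison maps ⟹ `ha`).

WHAT THIS FILE DOES. On a `D : JohnsonLeungKings2011.ZetaSkeleton R A H0 H1 H2` the module of Thm 5.2 (2) is `H1 ⧸ D.Z`,
`D.Z = 𝒥_Λ(ζ(χ))` = the span of the `_𝔞ζ(χ)`. The paper's §5.4 passes to Rubin's elliptic units through `ℐ𝒥ζ ⊂ 𝒥ζ` («the quotient
`𝒥_Ω(ζ(𝔣))/𝓘_Ω𝒥_Ω(ζ(𝔣))` is pseudo-null») and «up to torsion». Here, for ANY ideal `I` with `R/I` pseudo-null (e.g. `I = 𝒥_Λ`, `ℐ_Λ`,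
`ℐ_Λ𝒥_Λ`: kernels of characters `Λ → ℤ_p`, so `Λ/I` is finitely generated over `ℤ_p` and Part I applies — `not_le_of_moduleFinite_quotient`)
and ANY submodule `t ≤ H1` that is pseudo-null pointwise (e.g. finitely generated over `ℤ_p`: `lim← μ_{p^∞}`),
**`char(H1 ⧸ D.Z) = char(H1 ⧸ I • D.Z) = char(H1 ⧸ (I • D.Z ⊔ t))` EXACTLY** (`charIdeal_quotient_smul_Z_eq`, `…_sup_eq`), so the
rational identity (F2) for `(H1 ⧸ D.Z, H2)` transports verbatim to these variants (`exists_charIdeal_mul_pow_eq_transport_Z`): the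
typer may pin Rubin's `𝒞_∞^θ` against `ℐ𝒥ζ + torsion` and the Part II slot still receives (F2). The engine (§1) is generic: over
any commutative ring, a linear map whose kernel and cokernel are pseudo-null POINTWISE at every prime of height `≤ 1` is a
pseudo-isomorphism, hence (tree `charIdeal_eq_of_arePseudoIsomorphic`) preserves `Module.charIdeal` ON THE NOSE — no finiteness, no
torsion hypothesis, no `(ϖ)`-slack; and a module killed by an ideal `I` with `R/I` pseudo-null is pseudo-null.
HONEST FRAMING: bookkeeping; nothing here constructs a carrier or a comparison map; no summit statement is proved by this seat; BSD is not
proved by any of this.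

## Contents
* §1 (any commutative ring): `isPseudoNull_quotient_range_of_forall`, **`charIdeal_eq_of_forall_ker_coker`** (exact), `…_of_surjective_of_forall`,
  `…_of_injective_of_forall`; `forall_exists_mem_not_mem_iff_isPseudoNull_quotient` (`R/I` pseudo-null ⟺ `I ⊄ 𝔮` for all `𝔮` of height
  `≤ 1`), **`forall_exists_smul_eq_zero_of_forall_smul_mem_eq_zero`** (killed by such an `I` ⟹ pointwise pseudo-null).
* §2 (quotient sandwiches, any module `H`, submodules `N ≤ N'`): **`charIdeal_quotient_eq_of_le_of_forall`** (excess `N'/N` pointwise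
  pseudo-null ⟹ `char(H/N) = char(H/N')`), `charIdeal_quotient_smul_eq_of_forall` (`N = I • N'`), `charIdeal_quotient_sup_eq_of_forall`
  (`N' = N ⊔ t`), and the away-from-`ϖ` variant `exists_charIdeal_quotient_mul_pow_eq_of_le_of_away` (⟹ `≐`, needs `H/N` f.g. torsion
  over a Noetherian domain).
* §3 (the JLK skeleton): `not_le_of_jPseudoNullShape` (`D.JPseudoNullShape` + one index `a : A` ⟹ `D.J ⊄ 𝔮`, all `𝔮` of height `≤ 1`),
  **`charIdeal_quotient_J_smul_Z_eq`**, **`charIdeal_quotient_smul_Z_eq`**, **`charIdeal_quotient_smul_Z_sup_eq`**,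
  **`exists_charIdeal_mul_pow_eq_transport_Z`** ((F2) for `D.Z` ⟹ (F2) for `I • D.Z ⊔ t`).
* §4 (`Λ₂ = IwasawaAlgebra₂ p`): `not_le_of_moduleFinite_quotient_iwasawaAlgebra₂` — `Λ₂/I` finitely generated over `ℤ_p` ⟹ `I ⊄ 𝔮` for
  every `𝔮` of height `≤ 1` (Part I), the input of §3 for `I = ℐ, 𝒥, ℐ𝒥`.

THEOREMS ONLY (no `def`, no named fact, no `sorry`). presearch: JLK 2011 §5.1 (p0014:L40–48), §5.4 (p0015:L150–161) [corpus: arXiv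
0804.2828]; Neukirch–Schmidt–Wingberg V §1 (5.1.4)–(5.1.6); Bourbaki AC VII §4.4; folklore. beyond-print theorem: no.

References: J. Johnson-Leung, G. Kings, J. reine angew. Math. 653 (2011) §5.1, §5.4, Lemma 5.8 [JohnsonLeungKings2011];
Neukirch–Schmidt–Wingberg (2008) Ch. V §1 [NeukirchSchmidtWingberg2008]; L. Washington, *Cyclotomic Fields*, §13.2 [Washington1997].
-/

noncomputable section

set_option linter.dupNamespace false -- D-0017: single-problem summit, `…BirchSwinnertonDyer.BirchSwinnertonDyer…` repeats a namespace by design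
set_option autoImplicit false

open scoped Classical

namespace Summit.BirchSwinnertonDyer.BirchSwinnertonDyer.Theorems.PrintCf2.JLKDescent

open Literature.NumberTheory.EllipticCurves
open Literature.NumberTheory.ComplexMultiplication.EllipticUnits (JohnsonLeungKings2011.ZetaSkeleton)
open Summit.BirchSwinnertonDyer.BirchSwinnertonDyer.Theorems.PrintCf2.FourTerm

universe u₁ u₂ u₃ u₄

/-! ## §1. Exact `char`-equalities from pointwise pseudo-null kernels and cokernels; `I`-torsion with `R/I` pseudo-null -/

section Exact

variable {R : Type*} [CommRing R] {M : Type u₁} [AddCommGroup M] [Module R M] {N : Type u₂} [AddCommGroup N] [Module R N]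

/-- **Pointwise criterion for a pseudo-null cokernel**: if at every prime `𝔭` of height `≤ 1` every `n : N` has `r • n ∈ range f` for
some `r ∉ 𝔭`, then `N ⧸ range f` is pseudo-null. (Companion of the tree's `FourTerm.isPseudoNull_ker_of_forall`.)
[cite: NeukirchSchmidtWingberg2008, Ch. V §1, (5.1.4) Remark 1] -/
theorem isPseudoNull_quotient_range_of_forall (f : M →ₗ[R] N)
    (h : ∀ 𝔭 : PrimeSpectrum R, 𝔭.asIdeal.height ≤ 1 → ∀ n : N, ∃ r ∉ 𝔭.asIdeal, r • n ∈ LinearMap.range f) :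
    Module.IsPseudoNull R (N ⧸ LinearMap.range f) := by
  intro 𝔭 h𝔭
  rw [LocalizedModule.subsingleton_iff]
  intro q
  obtain ⟨n, rfl⟩ := Submodule.mkQ_surjective _ q
  obtain ⟨r, hr, hrn⟩ := h 𝔭 h𝔭 n
  refine ⟨r, hr, ?_⟩
  rw [Submodule.mkQ_apply, ← Submodule.Quotient.mk_smul, Submodule.Quotient.mk_eq_zero]
  exact hrn

/-- **Pointwise pseudo-null kernel AND cokernel ⟹ `char M = char N` EXACTLY** (any commutative ring; no finiteness or torsion
hypothesis): such an `f` is a pseudo-isomorphism, and pseudo-isomorphic modules have the same characteristic ideal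
(tree `charIdeal_eq_of_arePseudoIsomorphic`). Contrast the tree's ⊗ℚ producer `FourTerm.exists_charIdeal_mul_pow_eq_of_away_ker_coker`,
whose hypotheses skip the primes `𝔭 ∋ ϖ` and whose conclusion is only `≐`. [cite: Washington1997, §13.2] -/
theorem charIdeal_eq_of_forall_ker_coker (f : M →ₗ[R] N)
    (hker : ∀ 𝔭 : PrimeSpectrum R, 𝔭.asIdeal.height ≤ 1 → ∀ m : M, f m = 0 → ∃ r ∉ 𝔭.asIdeal, r • m = 0)
    (hcoker : ∀ 𝔭 : PrimeSpectrum R, 𝔭.asIdeal.height ≤ 1 → ∀ n : N, ∃ r ∉ 𝔭.asIdeal, r • n ∈ LinearMap.range f) :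
    Module.charIdeal R M = Module.charIdeal R N :=
  Module.charIdeal_eq_of_arePseudoIsomorphic
    ⟨f, isPseudoNull_ker_of_forall f hker, isPseudoNull_quotient_range_of_forall f hcoker⟩

/-- **Surjection with pointwise pseudo-null kernel ⟹ `char M = char N` exactly.** [cite: Washington1997, §13.2] -/
theorem charIdeal_eq_of_surjective_of_forall (f : M →ₗ[R] N) (hf : Function.Surjective f)
    (hker : ∀ 𝔭 : PrimeSpectrum R, 𝔭.asIdeal.height ≤ 1 → ∀ m : M, f m = 0 → ∃ r ∉ 𝔭.asIdeal, r • m = 0) :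
    Module.charIdeal R M = Module.charIdeal R N :=
  charIdeal_eq_of_forall_ker_coker f hker fun 𝔭 _ n ↦ ⟨1, 𝔭.isPrime.one_notMem, by
    rw [one_smul, LinearMap.range_eq_top.mpr hf]; exact Submodule.mem_top⟩

/-- **Injection with pointwise pseudo-null cokernel ⟹ `char M = char N` exactly.** [cite: Washington1997, §13.2] -/
theorem charIdeal_eq_of_injective_of_forall (f : M →ₗ[R] N) (hf : Function.Injective f)
    (hcoker : ∀ 𝔭 : PrimeSpectrum R, 𝔭.asIdeal.height ≤ 1 → ∀ n : N, ∃ r ∉ 𝔭.asIdeal, r • n ∈ LinearMap.range f) :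
    Module.charIdeal R M = Module.charIdeal R N :=
  charIdeal_eq_of_forall_ker_coker f (fun 𝔭 _ m hm ↦ ⟨1, 𝔭.isPrime.one_notMem, by
    rw [one_smul]; exact hf (by rw [hm, map_zero])⟩) hcoker

/-- **`R/I` is pseudo-null iff `I ⊄ 𝔮` for every prime `𝔮` of height `≤ 1`** (pointwise: some element of `I` lies outside `𝔮`;
`(R/I)_𝔮 = 0 ⟺ Ann(R/I) = I ⊄ 𝔮`). JLK §5.1: "`Λ/𝒥_Λ` [is] isomorphic to `ℤ_p` and hence pseudo-null … for all prime ideals `𝔮` of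
height `1`, `(𝒥_Λ)_𝔮 ≃ Λ_𝔮`". [cite: JohnsonLeungKings2011, §5.1 (arXiv p0014:L43–48)] -/
theorem forall_exists_mem_not_mem_iff_isPseudoNull_quotient (I : Ideal R) :
    (∀ 𝔮 : PrimeSpectrum R, 𝔮.asIdeal.height ≤ 1 → ∃ r ∈ I, r ∉ 𝔮.asIdeal) ↔ Module.IsPseudoNull R (R ⧸ I) := by
  refine ⟨fun h 𝔮 h𝔮 ↦ ?_, fun h 𝔮 h𝔮 ↦ ?_⟩
  · rw [LocalizedModule.subsingleton_iff]
    intro x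
    obtain ⟨r, hrI, hr𝔮⟩ := h 𝔮 h𝔮
    obtain ⟨y, rfl⟩ := Ideal.Quotient.mk_surjective x
    refine ⟨r, hr𝔮, ?_⟩
    rw [Algebra.smul_def, Ideal.Quotient.algebraMap_eq, ← map_mul, Ideal.Quotient.eq_zero_iff_mem]
    exact I.mul_mem_right y hrI
  · obtain ⟨r, hr, hr1⟩ := (LocalizedModule.subsingleton_iff.mp (h 𝔮 h𝔮)) (1 : R ⧸ I)
    refine ⟨r, ?_, hr⟩
    rw [Algebra.smul_def, mul_one, Ideal.Quotient.algebraMap_eq] at hr1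
    exact Ideal.Quotient.eq_zero_iff_mem.mp hr1

/-- **Killed by an ideal `I` with `I ⊄ 𝔮` for all `𝔮` of height `≤ 1` (i.e. `R/I` pseudo-null) ⟹ pointwise pseudo-null.** The
`𝒥`-, `ℐ`- and `ℐ𝒥`-torsion defects of the units row are of this kind. [cite: JohnsonLeungKings2011, §5.1 (arXiv p0014:L43–48)] -/
theorem forall_exists_smul_eq_zero_of_forall_smul_mem_eq_zero {I : Ideal R}
    (hI : ∀ 𝔮 : PrimeSpectrum R, 𝔮.asIdeal.height ≤ 1 → ∃ r ∈ I, r ∉ 𝔮.asIdeal) (hM : ∀ r ∈ I, ∀ m : M, r • m = 0) :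
    ∀ 𝔮 : PrimeSpectrum R, 𝔮.asIdeal.height ≤ 1 → ∀ m : M, ∃ r ∉ 𝔮.asIdeal, r • m = 0 := by
  intro 𝔮 h𝔮 m
  obtain ⟨r, hrI, hr𝔮⟩ := hI 𝔮 h𝔮
  exact ⟨r, hr𝔮, hM r hrI m⟩

/-- `Module.IsPseudoNull` form of `forall_exists_smul_eq_zero_of_forall_smul_mem_eq_zero`. [cite: JohnsonLeungKings2011, §5.1 (arXiv p0014:L43–48)] -/
theorem isPseudoNull_of_forall_smul_mem_eq_zero {I : Ideal R}
    (hI : ∀ 𝔮 : PrimeSpectrum R, 𝔮.asIdeal.height ≤ 1 → ∃ r ∈ I, r ∉ 𝔮.asIdeal) (hM : ∀ r ∈ I, ∀ m : M, r • m = 0) :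
    Module.IsPseudoNull R M := by
  intro 𝔮 h𝔮
  rw [LocalizedModule.subsingleton_iff]
  intro m
  obtain ⟨r, hr, hrm⟩ := forall_exists_smul_eq_zero_of_forall_smul_mem_eq_zero hI hM 𝔮 h𝔮 m
  exact ⟨r, hr, hrm⟩

end Exact

/-! ## §2. Quotient sandwiches: `N ≤ N' ≤ H` with pseudo-null excess `N'/N` -/

section Sandwich

variable {R : Type*} [CommRing R] {H : Type u₁} [AddCommGroup H] [Module R H]

/-- **`char(H/N) = char(H/N')` when `N ≤ N'` and the excess `N'/N` is pseudo-null pointwise** (for every prime `𝔮` of height `≤ 1`,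
every `y ∈ N'` has `r • y ∈ N` for some `r ∉ 𝔮`): the surjection `H/N ↠ H/N'` has pointwise pseudo-null kernel. Any module `H`
(not necessarily torsion — JLK's `H¹` has rank one), exact equality. [cite: NeukirchSchmidtWingberg2008, Ch. V §1, (5.1.4)–(5.1.6)] -/
theorem charIdeal_quotient_eq_of_le_of_forall {N N' : Submodule R H} (hle : N ≤ N')
    (h : ∀ 𝔮 : PrimeSpectrum R, 𝔮.asIdeal.height ≤ 1 → ∀ y ∈ N', ∃ r ∉ 𝔮.asIdeal, r • y ∈ N) :
    Module.charIdeal R (H ⧸ N) = Module.charIdeal R (H ⧸ N') := by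
  refine charIdeal_eq_of_surjective_of_forall (Submodule.factor hle) (Submodule.factor_surjective hle) fun 𝔮 h𝔮 x hx ↦ ?_
  obtain ⟨y, rfl⟩ := Submodule.mkQ_surjective N x
  rw [Submodule.factor_mk, Submodule.mkQ_apply, Submodule.Quotient.mk_eq_zero] at hx
  obtain ⟨r, hr, hry⟩ := h 𝔮 h𝔮 y hx
  refine ⟨r, hr, ?_⟩
  rw [Submodule.mkQ_apply, ← Submodule.Quotient.mk_smul, Submodule.Quotient.mk_eq_zero]
  exact hry

/-- **`char(H/(I • N')) = char(H/N')`** for an ideal `I` with `R/I` pseudo-null (pointwise: `I ⊄ 𝔮` for all `𝔮` of height `≤ 1`): the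
excess `N'/(I • N')` is killed by `I`. JLK §5.4: "The quotient `𝒥_Ω(ζ(𝔣))/𝓘_Ω𝒥_Ω(ζ(𝔣))` is pseudo-null."
[cite: JohnsonLeungKings2011, §5.4 (arXiv p0015:L156–158) and §5.1 (p0014:L43–48)] -/
theorem charIdeal_quotient_smul_eq_of_forall {I : Ideal R}
    (hI : ∀ 𝔮 : PrimeSpectrum R, 𝔮.asIdeal.height ≤ 1 → ∃ r ∈ I, r ∉ 𝔮.asIdeal) (N' : Submodule R H) :
    Module.charIdeal R (H ⧸ I • N') = Module.charIdeal R (H ⧸ N') :=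
  charIdeal_quotient_eq_of_le_of_forall Submodule.smul_le_right fun 𝔮 h𝔮 y hy ↦ by
    obtain ⟨r, hrI, hr𝔮⟩ := hI 𝔮 h𝔮
    exact ⟨r, hr𝔮, Submodule.smul_mem_smul hrI hy⟩

/-- **`char(H/N) = char(H/(N ⊔ t))`** for a submodule `t` that is pseudo-null pointwise (e.g. finitely generated over `ℤ_p` over
`Λ₂`, Part I — the "up to torsion" of JLK §5.4: `lim← μ_{p^∞}`). [cite: JohnsonLeungKings2011, §5.4 (arXiv p0015:L158–159)] -/
theorem charIdeal_quotient_sup_eq_of_forall (N t : Submodule R H)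
    (ht : ∀ 𝔮 : PrimeSpectrum R, 𝔮.asIdeal.height ≤ 1 → ∀ y ∈ t, ∃ r ∉ 𝔮.asIdeal, r • y ∈ N) :
    Module.charIdeal R (H ⧸ N) = Module.charIdeal R (H ⧸ N ⊔ t) :=
  charIdeal_quotient_eq_of_le_of_forall le_sup_left fun 𝔮 h𝔮 y hy ↦ by
    obtain ⟨n, hn, z, hz, rfl⟩ := Submodule.mem_sup.mp hy
    obtain ⟨r, hr, hrz⟩ := ht 𝔮 h𝔮 z hz
    exact ⟨r, hr, by rw [smul_add]; exact N.add_mem (N.smul_mem r hn) hrz⟩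

/-- A submodule that is pointwise pseudo-null AS A MODULE (every element killed by some `r ∉ 𝔮`) satisfies the excess hypothesis of
`charIdeal_quotient_sup_eq_of_forall` for every `N`. [folklore] -/
theorem forall_smul_mem_of_forall_smul_eq_zero (N t : Submodule R H)
    (ht : ∀ 𝔮 : PrimeSpectrum R, 𝔮.asIdeal.height ≤ 1 → ∀ y : t, ∃ r ∉ 𝔮.asIdeal, r • y = 0) :
    ∀ 𝔮 : PrimeSpectrum R, 𝔮.asIdeal.height ≤ 1 → ∀ y ∈ t, ∃ r ∉ 𝔮.asIdeal, r • y ∈ N := by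
  intro 𝔮 h𝔮 y hy
  obtain ⟨r, hr, hry⟩ := ht 𝔮 h𝔮 ⟨y, hy⟩
  refine ⟨r, hr, ?_⟩
  have : r • y = 0 := by simpa using congrArg Subtype.val hry
  rw [this]
  exact N.zero_mem

variable [IsNoetherianRing R] [IsDomain R] {ϖ : R}

/-- **Away-from-`ϖ` sandwich ⟹ `≐`**: if `N ≤ N'`, `H/N` is finitely generated torsion, and the excess `N'/N` is away-from-`ϖ`-null
pointwise (only at the primes `𝔮 ∌ ϖ`), then `∃ i j, char(H/N)·(ϖ)^i = char(H/N')·(ϖ)^j` — the `(ϖ)`-primary part of the excess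
(twist-vs-part, `#Δ_θ = 2`; index defects) is absorbed by the slack. [cite: NeukirchSchmidtWingberg2008, Ch. V §3, (5.3.9)–(5.3.10)] -/
theorem exists_charIdeal_quotient_mul_pow_eq_of_le_of_away (hϖ : Prime ϖ) {N N' : Submodule R H} (hle : N ≤ N')
    [Module.Finite R (H ⧸ N)] (hHN : Module.IsTorsion R (H ⧸ N))
    (h : ∀ 𝔮 : PrimeSpectrum R, 𝔮.asIdeal.height ≤ 1 → ϖ ∉ 𝔮.asIdeal → ∀ y ∈ N', ∃ r ∉ 𝔮.asIdeal, r • y ∈ N) :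
    ∃ i j : ℕ, Module.charIdeal R (H ⧸ N) * Ideal.span {ϖ} ^ i = Module.charIdeal R (H ⧸ N') * Ideal.span {ϖ} ^ j := by
  refine exists_charIdeal_mul_pow_eq_of_surjective_of_away hϖ hHN (Submodule.factor hle) (Submodule.factor_surjective hle)
    fun 𝔮 h𝔮 hϖ𝔮 x hx ↦ ?_
  obtain ⟨y, rfl⟩ := Submodule.mkQ_surjective N x
  rw [Submodule.factor_mk, Submodule.mkQ_apply, Submodule.Quotient.mk_eq_zero] at hx
  obtain ⟨r, hr, hry⟩ := h 𝔮 h𝔮 hϖ𝔮 y hx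
  refine ⟨r, hr, ?_⟩
  rw [Submodule.mkQ_apply, ← Submodule.Quotient.mk_smul, Submodule.Quotient.mk_eq_zero]
  exact hry

end Sandwich

/-! ## §3. On the Johnson-Leung–Kings skeleton: `𝒥ζ`, `I•𝒥ζ`, `I•𝒥ζ + torsion` have the same `char(H¹/–)` -/

section Skeleton

variable {R : Type*} [CommRing R] {A : Type*} {H0 : Type*} [AddCommGroup H0] [Module R H0]
  {H1 : Type u₁} [AddCommGroup H1] [Module R H1] {H2 : Type u₂} [AddCommGroup H2] [Module R H2]
  (D : JohnsonLeungKings2011.ZetaSkeleton R A H0 H1 H2)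

/-- **`D.JPseudoNullShape` ⟹ `D.J ⊄ 𝔮` for every prime `𝔮` of height `≤ 1`** (height one: `jPseudoNullShape_iff`; height zero, i.e.
`𝔮 = ⊥` over a domain: `D.J ∋ N𝔞 − σ_𝔞 ≠ 0` for the given index `a`, by `nsub_regular`). [cite: JohnsonLeungKings2011, §5.1 (arXiv p0014:L37–48)] -/
theorem not_le_of_jPseudoNullShape [IsDomain R] (h : D.JPseudoNullShape) (a : A) :
    ∀ 𝔮 : PrimeSpectrum R, 𝔮.asIdeal.height ≤ 1 → ∃ r ∈ D.J, r ∉ 𝔮.asIdeal := by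
  intro 𝔮 h𝔮
  by_cases h0 : 𝔮.asIdeal.height = 0
  · -- `𝔮 = ⊥`: `nsub a ∈ J` is non-zero
    have hbot : 𝔮.asIdeal = ⊥ := Ideal.height_eq_zero_iff_eq_bot.mp h0
    refine ⟨D.nsub a, D.nsub_mem_J a, ?_⟩
    rw [hbot, Ideal.mem_bot]
    intro hz
    have hreg := D.nsub_regular a
    rw [hz] at hreg
    exact not_subsingleton R (IsSMulRegular.zero_iff_subsingleton.mp hreg)
  · have h1 : 𝔮.asIdeal.height = 1 := le_antisymm h𝔮 (Order.one_le_iff_ne_zero.mpr h0)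
    have hJ : ¬ D.J ≤ 𝔮.asIdeal := (D.jPseudoNullShape_iff.mp h) 𝔮 h1
    obtain ⟨r, hrJ, hr𝔮⟩ := Set.not_subset.mp hJ
    exact ⟨r, hrJ, hr𝔮⟩

/-- **`char(H¹ ⧸ 𝒥_Λ·𝒥_Λ(ζ)) = char(H¹ ⧸ 𝒥_Λ(ζ))`** on a skeleton with `JPseudoNullShape` (the `𝒥`-defect is invisible).
[cite: JohnsonLeungKings2011, §5.1 (arXiv p0014:L43–48)] -/
theorem charIdeal_quotient_J_smul_Z_eq [IsDomain R] (h : D.JPseudoNullShape) (a : A) :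
    Module.charIdeal R (H1 ⧸ D.J • D.Z) = Module.charIdeal R (H1 ⧸ D.Z) :=
  charIdeal_quotient_smul_eq_of_forall (not_le_of_jPseudoNullShape D h a) D.Z

/-- **`char(H¹ ⧸ I·𝒥_Λ(ζ)) = char(H¹ ⧸ 𝒥_Λ(ζ))` for every ideal `I` with `R/I` pseudo-null** (`I ⊄ 𝔮` at height `≤ 1`) — for
`I = ℐ_Λ`, `ℐ_Λ𝒥_Λ`: JLK §5.4 "the quotient `𝒥_Ω(ζ(𝔣))/𝓘_Ω𝒥_Ω(ζ(𝔣))` is pseudo-null". Over `Λ₂` the hypothesis on `I` is supplied by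
`not_le_of_moduleFinite_quotient_iwasawaAlgebra₂` (§4). [cite: JohnsonLeungKings2011, §5.4 (arXiv p0015:L156–158)] -/
theorem charIdeal_quotient_smul_Z_eq {I : Ideal R}
    (hI : ∀ 𝔮 : PrimeSpectrum R, 𝔮.asIdeal.height ≤ 1 → ∃ r ∈ I, r ∉ 𝔮.asIdeal) :
    Module.charIdeal R (H1 ⧸ I • D.Z) = Module.charIdeal R (H1 ⧸ D.Z) :=
  charIdeal_quotient_smul_eq_of_forall hI D.Z

/-- **`char(H¹ ⧸ (I·𝒥_Λ(ζ) ⊔ t)) = char(H¹ ⧸ 𝒥_Λ(ζ))`** for `I` with `R/I` pseudo-null and a submodule `t ≤ H¹` pseudo-null pointwise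
(JLK §5.4: Rubin's elliptic units are "(up to torsion) the `Ω`-submodule generated by `𝓘_Ω𝒥_Ω(ζ(𝔤))`").
[cite: JohnsonLeungKings2011, §5.4 (arXiv p0015:L156–161)] -/
theorem charIdeal_quotient_smul_Z_sup_eq {I : Ideal R}
    (hI : ∀ 𝔮 : PrimeSpectrum R, 𝔮.asIdeal.height ≤ 1 → ∃ r ∈ I, r ∉ 𝔮.asIdeal) (t : Submodule R H1)
    (ht : ∀ 𝔮 : PrimeSpectrum R, 𝔮.asIdeal.height ≤ 1 → ∀ y : t, ∃ r ∉ 𝔮.asIdeal, r • y = 0) :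
    Module.charIdeal R (H1 ⧸ I • D.Z ⊔ t) = Module.charIdeal R (H1 ⧸ D.Z) := by
  rw [← charIdeal_quotient_sup_eq_of_forall (I • D.Z) t (forall_smul_mem_of_forall_smul_eq_zero (I • D.Z) t ht),
    charIdeal_quotient_smul_Z_eq D hI]

/-- **(F2) transports from `𝒥_Λ(ζ)` to `I·𝒥_Λ(ζ) + t`**: if `∃ i j, char(H¹/D.Z)·P^i = char(H²)·P^j` then the same holds with `D.Z`
replaced by `I • D.Z ⊔ t` (`I`, `t` as above) — so the typer may pin Rubin's `𝒞_∞^θ` against `ℐ𝒥ζ + torsion` and Part II's slot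
`hF2` is still served by the printed Thm 5.2. [cite: JohnsonLeungKings2011, Thm. 5.2 and §5.4 (arXiv p0014–p0016)] -/
theorem exists_charIdeal_mul_pow_eq_transport_Z (P : Ideal R) {I : Ideal R}
    (hI : ∀ 𝔮 : PrimeSpectrum R, 𝔮.asIdeal.height ≤ 1 → ∃ r ∈ I, r ∉ 𝔮.asIdeal) (t : Submodule R H1)
    (ht : ∀ 𝔮 : PrimeSpectrum R, 𝔮.asIdeal.height ≤ 1 → ∀ y : t, ∃ r ∉ 𝔮.asIdeal, r • y = 0)
    (hF2 : ∃ i j : ℕ, Module.charIdeal R (H1 ⧸ D.Z) * P ^ i = Module.charIdeal R H2 * P ^ j) :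
    ∃ i j : ℕ, Module.charIdeal R (H1 ⧸ I • D.Z ⊔ t) * P ^ i = Module.charIdeal R H2 * P ^ j := by
  rwa [charIdeal_quotient_smul_Z_sup_eq D hI t ht]

/-- The printed `D.Thm52Shape` gives `char(H¹ ⧸ (I·𝒥ζ ⊔ t)) = char(H²)` exactly, for `I`, `t` as above.
[cite: JohnsonLeungKings2011, Thm. 5.2 and §5.4 (arXiv p0014–p0016)] -/
theorem charIdeal_quotient_smul_Z_sup_eq_of_thm52Shape (hT : D.Thm52Shape) {I : Ideal R}
    (hI : ∀ 𝔮 : PrimeSpectrum R, 𝔮.asIdeal.height ≤ 1 → ∃ r ∈ I, r ∉ 𝔮.asIdeal) (t : Submodule R H1)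
    (ht : ∀ 𝔮 : PrimeSpectrum R, 𝔮.asIdeal.height ≤ 1 → ∀ y : t, ∃ r ∉ 𝔮.asIdeal, r • y = 0) :
    Module.charIdeal R (H1 ⧸ I • D.Z ⊔ t) = Module.charIdeal R H2 := by
  rw [charIdeal_quotient_smul_Z_sup_eq D hI t ht, hT.charIdeal_eq]

end Skeleton

/-! ## §4. `Λ₂ = IwasawaAlgebra₂ p`: `Λ₂/I` finitely generated over `ℤ_p` ⟹ `I ⊄ 𝔮` at height `≤ 1` -/

section IwasawaTwo

variable {p : ℕ} [Fact p.Prime]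

/-- **`Λ₂/I` finitely generated over `ℤ_p` ⟹ `I ⊄ 𝔮` for every prime `𝔮` of height `≤ 1`** (Part I: such a `Λ₂/I` is pseudo-null;
then §1). The ideals of the units row are of this kind: `Λ₂/𝒥_Λ ≅ ℤ_p`, `Λ₂/ℐ_Λ ≅ ℤ_p` (kernels of the cyclotomic character / the
augmentation), `Λ₂/ℐ𝒥` (an extension of the two). [cite: JohnsonLeungKings2011, §5.1 (arXiv p0014:L43–48)] -/
theorem not_le_of_moduleFinite_quotient_iwasawaAlgebra₂ (I : Ideal (IwasawaAlgebra₂ p))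
    [Module.Finite ℤ_[p] (IwasawaAlgebra₂ p ⧸ I)] :
    ∀ 𝔮 : PrimeSpectrum (IwasawaAlgebra₂ p), 𝔮.asIdeal.height ≤ 1 → ∃ r ∈ I, r ∉ 𝔮.asIdeal :=
  (forall_exists_mem_not_mem_iff_isPseudoNull_quotient I).mpr (isPseudoNull_of_moduleFinite_iwasawaAlgebra₂ (M := IwasawaAlgebra₂ p ⧸ I))

/-- **A `Λ₂`-module killed by an ideal `I` with `Λ₂/I` finitely generated over `ℤ_p` is pseudo-null, pointwise.**
[cite: JohnsonLeungKings2011, §5.1 (arXiv p0014:L43–48)] -/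
theorem forall_exists_smul_eq_zero_of_smul_eq_zero_of_moduleFinite_quotient {M : Type u₁} [AddCommGroup M]
    [Module (IwasawaAlgebra₂ p) M] (I : Ideal (IwasawaAlgebra₂ p)) [Module.Finite ℤ_[p] (IwasawaAlgebra₂ p ⧸ I)]
    (hM : ∀ r ∈ I, ∀ m : M, r • m = 0) :
    ∀ 𝔮 : PrimeSpectrum (IwasawaAlgebra₂ p), 𝔮.asIdeal.height ≤ 1 → ∀ m : M, ∃ r ∉ 𝔮.asIdeal, r • m = 0 :=
  forall_exists_smul_eq_zero_of_forall_smul_mem_eq_zero (not_le_of_moduleFinite_quotient_iwasawaAlgebra₂ I) hM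

end IwasawaTwo



end Summit.BirchSwinnertonDyer.BirchSwinnertonDyer.Theorems.PrintCf2.JLKDescent

end
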